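import Summits.CriticalPhenomena.PercolationContinuityZ3.Theorems.PercNearOneGluingNoHeavyLowerTailAntitheticPairCertificate
import Summits.CriticalPhenomena.PercolationContinuityZ3.Theorems.PercNearOneGluingNoHeavyLowerTailAntitheticDegTwoOneSided
import Summits.CriticalPhenomena.PercolationContinuityZ3.Theorems.PercNearOneGluingNoHeavyLowerTailAntitheticCherryOplus
import Mathlib.Combinatorics.SimpleGraph.Connectivity.Finite
import HarnessLib

/-!
# `NoHeavyLowerTail` (stmt-CriticalPhenomena-4575) — antithetic cluster pairs: **FAT8** (prim-hp-2 gen 58)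

Support file (`--supports stmt-CriticalPhenomena-4575`, hull-port prover `prim-hp-2`, gen 58).  No definitions, no named facts, no sorries.
FAT8 (MEMO-gen54: `s` + the complete binary tree of depth 2, `R = {root}`; n = 8, m = 12) is the smallest graph WITHOUT a symmetric Harris
tree; here the VERTEX antithetic conjecture at `R = {x}` is proved for it as a TREE THEOREM by the one-sided route of HOME/THEOREM-OneSided.md:
deg-2 elimination + TERM I (block freezing) + the cut-vertex composition theorem (`Antithetic.DegTwo.cutVertex_vertex_sum_nonneg`,
…AntitheticDegTwoOneSided) fed with the ⊕-positivity of the cherry fan (`Antithetic.Cherry.cherry_oplus_powerset`, …AntitheticCherryOplus,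
a `native_decide`-checked 𝒦⁺ certificate) transported to colouring sums by `Antithetic.sum_filter_inter_nonneg` (…AntitheticPairCertificate).
Vertices: `s = 0`, hubs `y = 1`, `z = 4`, leaves `2, 3` and `5, 6`, `x = 7` (degree 2, not adjacent to `s`); edges
`01, 12, 13, 02, 03, 04, 45, 46, 05, 06, 71, 74`.
**`Antithetic.Fat8.fat8_vertex_antithetic`**: for all monotone `F, G : Set (Fin 8) → ℝ`,
`0 ≤ Σ_{ω : ¬(x ∈ X ω ∧ x ∈ Y ω)} (F (X ω) − F (Y ω)) (G (X ω) − G (Y ω))`, `X ω / Y ω` the red / blue vertex clusters of `s`.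
[cite: VandenbergHaggstromKahn2005, §1 p. 6 ("Harris' inequality")]
-/

noncomputable section

namespace Summit.CriticalPhenomena.PercolationContinuityZ3.Theorems

open Literature.Probability.Percolation
open scoped Classical

namespace Antithetic

namespace Fat8

/-- **FAT8** (MEMO-gen54's counterexample to symmetric Harris trees): vertices `s = 0`, hubs `1, 4`, leaves `2,3` and `5,6`, the
degree-2 vertex `x = 7 ∉ N(s)`; edges `01,12,13,02,03, 04,45,46,05,06, 71,74`.  The VERTEX antithetic sum over `D({7})` is `≥ 0` for
all monotone `F, G`. [this work] -/
theorem fat8_vertex_antithetic (F G : Set (Fin 8) → ℝ) (hF : Monotone F) (hG : Monotone G) :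
    0 ≤ ∑ ω ∈ Finset.univ.filter (fun ω : Set (Sym2 (Fin 8)) =>
        ¬ ((openGraph (ω ∩ ↑({s(0, 1), s(1, 2), s(1, 3), s(0, 2), s(0, 3), s(0, 4), s(4, 5), s(4, 6), s(0, 5), s(0, 6), s(7, 1), s(7, 4)} :
            Finset (Sym2 (Fin 8))))).Reachable 0 7 ∧
          (openGraph (ωᶜ ∩ ↑({s(0, 1), s(1, 2), s(1, 3), s(0, 2), s(0, 3), s(0, 4), s(4, 5), s(4, 6), s(0, 5), s(0, 6), s(7, 1), s(7, 4)} :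
            Finset (Sym2 (Fin 8))))).Reachable 0 7)),
      (F (openCluster (ω ∩ ↑({s(0, 1), s(1, 2), s(1, 3), s(0, 2), s(0, 3), s(0, 4), s(4, 5), s(4, 6), s(0, 5), s(0, 6), s(7, 1), s(7, 4)} :
            Finset (Sym2 (Fin 8)))) 0) -
        F (openCluster (ωᶜ ∩ ↑({s(0, 1), s(1, 2), s(1, 3), s(0, 2), s(0, 3), s(0, 4), s(4, 5), s(4, 6), s(0, 5), s(0, 6), s(7, 1), s(7, 4)} :
            Finset (Sym2 (Fin 8)))) 0)) *
      (G (openCluster (ω ∩ ↑({s(0, 1), s(1, 2), s(1, 3), s(0, 2), s(0, 3), s(0, 4), s(4, 5), s(4, 6), s(0, 5), s(0, 6), s(7, 1), s(7, 4)} :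
            Finset (Sym2 (Fin 8)))) 0) -
        G (openCluster (ωᶜ ∩ ↑({s(0, 1), s(1, 2), s(1, 3), s(0, 2), s(0, 3), s(0, 4), s(4, 5), s(4, 6), s(0, 5), s(0, 6), s(7, 1), s(7, 4)} :
            Finset (Sym2 (Fin 8)))) 0)) := by
  -- the two sides (cherry fans) and their vertex sets
  have hE₁v : ∀ e ∈ ({s(0, 1), s(1, 2), s(1, 3), s(0, 2), s(0, 3)} : Finset (Sym2 (Fin 8))), ∀ v : Fin 8, v ∈ e →
      v = 0 ∨ v ∈ ({1, 2, 3} : Finset (Fin 8)) := by decide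
  have hE₂v : ∀ e ∈ ({s(0, 4), s(4, 5), s(4, 6), s(0, 5), s(0, 6)} : Finset (Sym2 (Fin 8))), ∀ v : Fin 8, v ∈ e →
      v = 0 ∨ v ∈ ({4, 5, 6} : Finset (Fin 8)) := by decide
  have hdegf : ∀ h ∈ ({s(0, 1), s(1, 2), s(1, 3), s(0, 2), s(0, 3), s(0, 4), s(4, 5), s(4, 6), s(0, 5), s(0, 6), s(7, 1), s(7, 4)} : Finset (Sym2 (Fin 8))),
      (7 : Fin 8) ∈ h → h = s(7, 1) ∨ h = s(7, 4) := by decide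
  have hsplit : (({s(0, 1), s(1, 2), s(1, 3), s(0, 2), s(0, 3), s(0, 4), s(4, 5), s(4, 6), s(0, 5), s(0, 6), s(7, 1), s(7, 4)} : Finset (Sym2 (Fin 8))) \ {s(7, 1), s(7, 4)}) = ({s(0, 1), s(1, 2), s(1, 3), s(0, 2), s(0, 3)} : Finset (Sym2 (Fin 8))) ∪ ({s(0, 4), s(4, 5), s(4, 6), s(0, 5), s(0, 6)} : Finset (Sym2 (Fin 8))) := by decide
  -- abstract the three edge sets (keeps unification cheap), then instantiate
  have key : ∀ E A B : Set (Sym2 (Fin 8)), E = ↑({s(0, 1), s(1, 2), s(1, 3), s(0, 2), s(0, 3), s(0, 4), s(4, 5), s(4, 6), s(0, 5), s(0, 6), s(7, 1), s(7, 4)} : Finset (Sym2 (Fin 8))) →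
      A = ↑({s(0, 1), s(1, 2), s(1, 3), s(0, 2), s(0, 3)} : Finset (Sym2 (Fin 8))) → B = ↑({s(0, 4), s(4, 5), s(4, 6), s(0, 5), s(0, 6)} : Finset (Sym2 (Fin 8))) →
      0 ≤ ∑ ω ∈ Finset.univ.filter (fun ω : Set (Sym2 (Fin 8)) =>
        ¬ ((openGraph (ω ∩ E)).Reachable 0 7 ∧ (openGraph (ωᶜ ∩ E)).Reachable 0 7)),
      (F (openCluster (ω ∩ E) 0) - F (openCluster (ωᶜ ∩ E) 0)) * (G (openCluster (ω ∩ E) 0) - G (openCluster (ωᶜ ∩ E) 0)) := by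
    intro E A B hE hA hB
    have he : s((7 : Fin 8), (1 : Fin 8)) ∈ E := by rw [hE]; exact Finset.mem_coe.2 (by decide)
    have hf : s((7 : Fin 8), (4 : Fin 8)) ∈ E := by rw [hE]; exact Finset.mem_coe.2 (by decide)
    have hdeg : ∀ h ∈ E, (7 : Fin 8) ∈ h → h = s(7, 1) ∨ h = s(7, 4) := fun h hh => hdegf h (Finset.mem_coe.1 (hE ▸ hh))
    have hg : s((1 : Fin 8), (4 : Fin 8)) ∉ E := fun h => absurd (Finset.mem_coe.1 (hE ▸ h)) (by decide)
    have hE' : E \ {s((7 : Fin 8), (1 : Fin 8)), s((7 : Fin 8), (4 : Fin 8))} = A ∪ B := by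
      rw [hE, hA, hB, show ({s(7, 1), s(7, 4)} : Set (Sym2 (Fin 8))) = ↑({s(7, 1), s(7, 4)} : Finset (Sym2 (Fin 8))) by simp,
        ← Finset.coe_sdiff, ← Finset.coe_union, hsplit]
    have hU : Disjoint (↑({1, 2, 3} : Finset (Fin 8)) : Set (Fin 8)) ↑({4, 5, 6} : Finset (Fin 8)) :=
      Finset.disjoint_coe.2 (by decide)
    have hs₁ : (0 : Fin 8) ∉ (↑({1, 2, 3} : Finset (Fin 8)) : Set (Fin 8)) := fun h => absurd (Finset.mem_coe.1 h) (by decide)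
    have hs₂ : (0 : Fin 8) ∉ (↑({4, 5, 6} : Finset (Fin 8)) : Set (Fin 8)) := fun h => absurd (Finset.mem_coe.1 h) (by decide)
    have hE₁ : ∀ e ∈ A, ∀ v ∈ e, v = (0 : Fin 8) ∨ v ∈ (↑({1, 2, 3} : Finset (Fin 8)) : Set (Fin 8)) := by
      intro e he v hv
      rw [hA] at he
      rcases hE₁v e (Finset.mem_coe.1 he) v hv with h | h
      · exact Or.inl h
      · exact Or.inr (Finset.mem_coe.2 h)
    have hE₂ : ∀ e ∈ B, ∀ v ∈ e, v = (0 : Fin 8) ∨ v ∈ (↑({4, 5, 6} : Finset (Fin 8)) : Set (Fin 8)) := by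
      intro e he v hv
      rw [hB] at he
      rcases hE₂v e (Finset.mem_coe.1 he) v hv with h | h
      · exact Or.inl h
      · exact Or.inr (Finset.mem_coe.2 h)
    have hdis : Disjoint A B := by rw [hA, hB]; exact Finset.disjoint_coe.2 (by decide)
    have hyU : (1 : Fin 8) ∈ (↑({1, 2, 3} : Finset (Fin 8)) : Set (Fin 8)) := Finset.mem_coe.2 (by decide)
    have hzU : (4 : Fin 8) ∈ (↑({4, 5, 6} : Finset (Fin 8)) : Set (Fin 8)) := Finset.mem_coe.2 (by decide)
    -- ⊕-positivity of the cherry side: restrict the colouring sum to A = E₁ and use the certificate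
    have hplus : ∀ K₁ K₂ : Set (Fin 8) → Set (Fin 8) → ℝ,
        (∀ ⦃P P' Q Q' : Set (Fin 8)⦄, P ⊆ P' → Q' ⊆ Q → K₁ P Q ≤ K₁ P' Q') → (∀ P Q, 0 ≤ K₁ P Q + K₁ Q P) →
        (∀ ⦃P P' Q Q' : Set (Fin 8)⦄, P ⊆ P' → Q' ⊆ Q → K₂ P Q ≤ K₂ P' Q') → (∀ P Q, 0 ≤ K₂ P Q + K₂ Q P) →
        0 ≤ ∑ ω ∈ Finset.univ.filter (fun ω : Set (Sym2 (Fin 8)) => (1 : Fin 8) ∈ openCluster (ω ∩ A) 0),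
          K₁ (openCluster (ω ∩ A) 0) (openCluster (ωᶜ ∩ A) 0) * K₂ (openCluster (ω ∩ A) 0) (openCluster (ωᶜ ∩ A) 0) := by
      intro K₁ K₂ hK₁ hso₁ hK₂ hso₂
      have hc : ∀ ω : Set (Sym2 (Fin 8)), ωᶜ ∩ A = A \ (ω ∩ A) := fun ω => compl_inter_eq_diff ω A
      simp_rw [hc]
      refine sum_filter_inter_nonneg A (fun η => (1 : Fin 8) ∈ openCluster η 0)
        (fun η => K₁ (openCluster η 0) (openCluster (A \ η) 0) * K₂ (openCluster η 0) (openCluster (A \ η) 0)) ?_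
      subst hA
      -- index the sub-colourings of E₁ by Finsets
      have hset : (Finset.univ.filter fun η : Set (Sym2 (Fin 8)) => η ⊆ ↑({s(0, 1), s(1, 2), s(1, 3), s(0, 2), s(0, 3)} : Finset (Sym2 (Fin 8)))).filter
            (fun η => (1 : Fin 8) ∈ openCluster η 0) =
          ((({s(0, 1), s(1, 2), s(1, 3), s(0, 2), s(0, 3)} : Finset (Sym2 (Fin 8)))).powerset.filter
            fun (θ : Finset (Sym2 (Fin 8))) => (1 : Fin 8) ∈ openCluster (↑θ : Set (Sym2 (Fin 8))) 0).image
            (fun (θ : Finset (Sym2 (Fin 8))) => (↑θ : Set (Sym2 (Fin 8)))) := by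
        ext η
        simp only [Finset.mem_filter, Finset.mem_univ, true_and, Finset.mem_image, Finset.mem_powerset]
        constructor
        · rintro ⟨hsub, hp⟩
          have hco : (↑((({s(0, 1), s(1, 2), s(1, 3), s(0, 2), s(0, 3)} : Finset (Sym2 (Fin 8)))).filter fun e => e ∈ η) :
              Set (Sym2 (Fin 8))) = η := by
            ext e
            simp only [Finset.coe_filter, Set.mem_setOf_eq]
            exact ⟨fun h => h.2, fun h => ⟨Finset.mem_coe.1 (hsub h), h⟩⟩
          refine ⟨(({s(0, 1), s(1, 2), s(1, 3), s(0, 2), s(0, 3)} : Finset (Sym2 (Fin 8)))).filter fun e => e ∈ η, ⟨Finset.filter_subset _ _, ?_⟩, hco⟩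
          rw [hco]; exact hp
        · rintro ⟨θ, ⟨hθ, hp⟩, rfl⟩
          exact ⟨Finset.coe_subset.2 hθ, hp⟩
      rw [hset, Finset.sum_image (fun θ₁ _ θ₂ _ h => Finset.coe_injective h)]
      simp_rw [← Finset.coe_sdiff]
      convert Cherry.cherry_oplus_powerset K₁ K₂ hK₁ hso₁ hK₂ hso₂ using 2
      exact Finset.filter_congr fun θ _ => by unfold openCluster openGraph; exact Iff.rfl
    have h := DegTwo.cutVertex_vertex_sum_nonneg (V := Fin 8) (E := E) (s := (0 : Fin 8)) (x := 7) (y := 1) (z := 4) (by decide) (by decide) (by decide)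
      (by decide) he hf hdeg hg A B _ _ hE' hU hs₁ hs₂ hE₁ hE₂ hdis hyU hzU hplus hF hG
    convert h using 3
  exact key _ _ _ rfl rfl rfl

end Fat8

end Antithetic

end Summit.CriticalPhenomena.PercolationContinuityZ3.Theorems
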